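import Summits.RiemannHypothesis.RiemannHypothesis.Theorems.WeilFormatCTailJPrelim
import Summits.RiemannHypothesis.RiemannHypothesis.Theorems.WeilFormatCMeanSquareGeneric
import HarnessLib

/-!
# Format C, L-C3b mean-square tail: `Σ_m F_m²·P(m)²` against the MEAN SQUARE of the prime sum

Route context: Fourier–Galerkin / Schur-complement certificates of Weil positivity on a window ("format C";
cell memo `run/shared/lean/pub/rh-explicit/rh-explicit-weil-10/FORMATC-DESIGN.md` §9.9.3 (ii); supporting
stmt-RiemannHypothesis-0098; seat rh-explicit-weil-10; lead ruling R7-43 (2)).  In the order-`J` tail majorants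
(`WeilFormatC.even/odd_tailJ_majorant`) the `A`-family term is `Σ_{m≥B₃} F_m²·P_A(m)²` with the mode function
`F_m = ½Y_m + Σ_k (Λ_k/√k) sin(ω_m log k) − T_m`; there it is bounded through `F_m² ≤ C_A²`
(`C_A = π/4 + Σ_kΛ_k/√k + a(1+E)/(πB₃)`, `C_A² ≈ 17.2` at `a = 1`).  Here (specialising
`WeilFormatCMeanSquareGeneric`): `F_m² = G_m² + 2G_mS_m + S_m²` with `|G_m − π/4| ≤ c = a(1+E)/(πB₃)` and
`S_m² = ½Σ_kw_k² + (oscillatory)`, so that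

* `sum_Ico_modeF_sq_mul_sq_le` — `Σ_{m∈Ico B₃ N} F_m²(Σ_j α_j/m^{e_j})² ≤ c̄·Q_Ẑ(α) + Σ_j α_j²Σ_{j'} (R/B₃^{e_j+e_{j'}})λ_{j'}/λ_j`,
  `c̄ = (π/4 + c)² + ½Σ_kw_k² + 2cΣ_kw_k + κ` (`≈ 1.53 + κ` at `a = 1`), `Q_Ẑ` the Hankel form of
  `sum_Ico_sq_sum_div_pow_le`, and `R`, `κ` the RESONANCE constants of the data `s₁(k) ≤ |sin(θ_k/2)|`,
  `s₋(k,k') ≤ |sin((θ_k−θ_{k'})/2)|`, `s₊(k,k') ≤ |sin((θ_k+θ_{k'})/2)|` (`θ_k = π log k/a`; a zero datum moves that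
  frequency's weight from `R` into `κ`, which is how exact or sharp resonances — two prime powers with `kk' ≈ e^{2a}` —
  are handled).

Small-divisor sets at the rungs of record (all prime powers `k < e^{2a}`; `1/|sin|` in brackets; numerics are NOT
hypotheses of this file): CAL `(log 3)/2`: `P = {2}`, none, `R = 1.00`; `0.83`: `{2,3,4,5}`, `s₁(5)` [10.5], `R = 22.4`;
`0.9`: `s₊(2,3)` [69.5] (crude: `κ += w₂w₃ = 0.31`); `1`: `{2,3,4,5,7}`, `s₁(7)` [11.8], `s₊(2,4)` [8.0], `s₊(7,7)` [5.9],
`R = 32.2`; `1.039`: `s₊(2,4)` [458.8] (crude: `κ += 0.17`, then `R ≈ 22`); `1.098`: `s₊(3,3)` [2.8·10⁴] (crude).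
Standard axioms; no definitions; no RH claim.
-/

set_option autoImplicit false
-- `Summit.RiemannHypothesis.RiemannHypothesis.…` is the layout-mandated namespace (summit = problem name).
set_option linter.dupNamespace false

noncomputable section

open Complex Finset
open scoped Real BigOperators ArithmeticFunction.vonMangoldt

namespace Summit.RiemannHypothesis.RiemannHypothesis.Theorems.WeilFormatC

open Literature.NumberTheory.LFunctions Literature.NumberTheory.LFunctions.Yoshida1992
open Literature.Analysis.SpecialFunctions

variable {a : ℝ}

/-! ## The smooth part of the mode function -/

section Smooth

/-- `|G_m − π/4| ≤ a(1+E)/(πm)` for `m ≥ 1`, `G_m = ½Y_m − T_m`. -/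
theorem abs_smoothMode_sub_le (ha : 0 < a) {m : ℕ} (hm : 1 ≤ m) :
    |(Complex.digamma (1 / 4 + ((freq a m : ℝ) : ℂ) / 2 * I)).im / 2 - archExpSumSin a m - π / 4|
      ≤ a * (1 + weilArchDensity (2 * a)) / (π * m) := by
  have hm0 : (0 : ℝ) < m := by exact_mod_cast hm
  have hY := abs_im_digamma_freq_sub_le ha hm
  have hT0 := archExpSumSin_nonneg ha hm
  have hT := archExpSumSin_le ha hm
  have hE0 : 0 < weilArchDensity (2 * a) := weilArchDensity_pos (by positivity)
  rw [abs_le] at hY ⊢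
  have e1 : a * (1 + weilArchDensity (2 * a)) / (π * m) = a / (π * m) + weilArchDensity (2 * a) * a / (π * m) := by ring
  have e2 : 2 * a / (π * (m : ℝ)) = 2 * (a / (π * m)) := by ring
  rw [e2] at hY
  constructor <;> nlinarith [hY.1, hY.2, hT0, hT, e1, (by positivity : 0 ≤ a / (π * m))]

/-- `ω_m · log k = m · θ_k` with `θ_k = π log k / a`. -/
theorem freq_mul_log_eq (a : ℝ) (m : ℕ) (k : ℕ) :
    freq a m * Real.log k = (m : ℝ) * (π * Real.log k / a) := by
  rw [freq_natCast]; ring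

end Smooth

/-! ## The mean-square Gram bound -/

section MeanSquare

/-- **The mean-square Gram bound.**  See the module docstring.  The data `s₁ k`, `s₋ k k'`, `s₊ k k'` are
non-negative lower bounds for `|sin(θ_k/2)|`, `|sin((θ_k−θ_{k'})/2)|`, `|sin((θ_k+θ_{k'})/2)|` at the prime powers of
the window; the value `0` switches that frequency to the crude bound (its weight joins `κ`, the last summand of `c̄`;
its term of `R` is `x/0 = 0`). -/
theorem sum_Ico_modeF_sq_mul_sq_le (ha : 0 < a) {B₃ : ℕ} (hB₃ : 2 ≤ B₃) {D : ℕ} (e : Fin D → ℕ)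
    (he : ∀ j, 1 ≤ e j) (lam : Fin D → ℝ) (hlam : ∀ j, 0 < lam j)
    (s₁ : ℕ → ℝ) (sm sp : ℕ → ℕ → ℝ)
    (hs₁ : ∀ k ∈ weilPrimeIndex a, IsPrimePow k → 0 ≤ s₁ k ∧ s₁ k ≤ |Real.sin (π * Real.log k / a / 2)|)
    (hsm : ∀ k ∈ weilPrimeIndex a, ∀ k' ∈ weilPrimeIndex a, IsPrimePow k → IsPrimePow k' → k ≠ k' →
      0 ≤ sm k k' ∧ sm k k' ≤ |Real.sin ((π * Real.log k / a - π * Real.log k' / a) / 2)|)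
    (hsp : ∀ k ∈ weilPrimeIndex a, ∀ k' ∈ weilPrimeIndex a, IsPrimePow k → IsPrimePow k' →
      0 ≤ sp k k' ∧ sp k k' ≤ |Real.sin ((π * Real.log k / a + π * Real.log k' / a) / 2)|)
    (N : ℕ) (α : Fin D → ℝ) :
    ∑ m ∈ Finset.Ico B₃ N,
        ((Complex.digamma (1 / 4 + ((freq a m : ℝ) : ℂ) / 2 * I)).im / 2
          + (∑ k ∈ weilPrimeIndex a, (Λ k : ℝ) / Real.sqrt k * Real.sin (freq a m * Real.log k))
          - archExpSumSin a m) ^ 2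
        * (∑ j, α j / (m : ℝ) ^ e j) ^ 2
      ≤ ((π / 4 + a * (1 + weilArchDensity (2 * a)) / (π * B₃)) ^ 2
            + (∑ k ∈ weilPrimeIndex a, ((Λ k : ℝ) / Real.sqrt k) ^ 2) / 2
            + 2 * (a * (1 + weilArchDensity (2 * a)) / (π * B₃)) * (∑ k ∈ weilPrimeIndex a, (Λ k : ℝ) / Real.sqrt k)
            + ((π / 2) * (∑ k ∈ weilPrimeIndex a, if s₁ k = 0 then (Λ k : ℝ) / Real.sqrt k else 0)
              + (∑ k ∈ weilPrimeIndex a, ∑ k' ∈ (weilPrimeIndex a).erase k,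
                  if sm k k' = 0 then (Λ k : ℝ) / Real.sqrt k * ((Λ k' : ℝ) / Real.sqrt k') else 0) / 2
              + (∑ k ∈ weilPrimeIndex a, ∑ k' ∈ weilPrimeIndex a,
                  if sp k k' = 0 then (Λ k : ℝ) / Real.sqrt k * ((Λ k' : ℝ) / Real.sqrt k') else 0) / 2))
          * ((∑ j, ∑ j', α j * α j' *
              ((1 / ((e j + e j' - 1 : ℕ) * (((B₃ - 1 : ℕ) : ℝ)) ^ (e j + e j' - 1))
                + 1 / ((e j + e j' - 1 : ℕ) * (B₃ : ℝ) ^ (e j + e j' - 1))) / 2))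
            + ∑ j, α j ^ 2 * ∑ j',
              ((1 / ((e j + e j' - 1 : ℕ) * (((B₃ - 1 : ℕ) : ℝ)) ^ (e j + e j' - 1))
                - 1 / ((e j + e j' - 1 : ℕ) * (B₃ : ℝ) ^ (e j + e j' - 1))) / 2) * lam j' / lam j)
        + ∑ j, α j ^ 2 * ∑ j',
            ((π / 2) * (∑ k ∈ weilPrimeIndex a, (Λ k : ℝ) / Real.sqrt k / s₁ k)
              + (∑ k ∈ weilPrimeIndex a, ∑ k' ∈ (weilPrimeIndex a).erase k,
                  (Λ k : ℝ) / Real.sqrt k * ((Λ k' : ℝ) / Real.sqrt k') / sm k k') / 2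
              + (∑ k ∈ weilPrimeIndex a, ∑ k' ∈ weilPrimeIndex a,
                  (Λ k : ℝ) / Real.sqrt k * ((Λ k' : ℝ) / Real.sqrt k') / sp k k') / 2)
            / (B₃ : ℝ) ^ (e j + e j') * lam j' / lam j := by
  have hB₃1 : 1 ≤ B₃ := by omega
  have hB0 : (0 : ℝ) < B₃ := by exact_mod_cast (by omega : 0 < B₃)
  have hE0 : 0 < weilArchDensity (2 * a) := weilArchDensity_pos (by positivity)
  have hc : 0 ≤ a * (1 + weilArchDensity (2 * a)) / (π * B₃) := by positivity
  have hw : ∀ k, 0 ≤ (Λ k : ℝ) / Real.sqrt k :=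
    fun k ↦ div_nonneg ArithmeticFunction.vonMangoldt_nonneg (Real.sqrt_nonneg _)
  have hwz : ∀ k, ¬ IsPrimePow k → (Λ k : ℝ) / Real.sqrt k = 0 := fun k hk ↦ by
    rw [ArithmeticFunction.vonMangoldt_eq_zero_iff.mpr hk, zero_div]
  -- the data in the generic ("zero weight or sine bound") form
  have hs₁' : ∀ k ∈ weilPrimeIndex a, (Λ k : ℝ) / Real.sqrt k = 0 ∨
      (0 ≤ s₁ k ∧ s₁ k ≤ |Real.sin (π * Real.log k / a / 2)|) := fun k hk ↦ by
    by_cases hkp : IsPrimePow k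
    · exact Or.inr (hs₁ k hk hkp)
    · exact Or.inl (hwz k hkp)
  have hsm' : ∀ k ∈ weilPrimeIndex a, ∀ k' ∈ weilPrimeIndex a, k ≠ k' →
      (Λ k : ℝ) / Real.sqrt k * ((Λ k' : ℝ) / Real.sqrt k') = 0 ∨
        (0 ≤ sm k k' ∧ sm k k' ≤ |Real.sin ((π * Real.log k / a - π * Real.log k' / a) / 2)|) :=
    fun k hk k' hk' hne ↦ by
      by_cases hkp : IsPrimePow k ∧ IsPrimePow k'
      · exact Or.inr (hsm k hk k' hk' hkp.1 hkp.2 hne)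
      · refine Or.inl ?_
        rcases not_and_or.mp hkp with h | h
        · rw [hwz k h, zero_mul]
        · rw [hwz k' h, mul_zero]
  have hsp' : ∀ k ∈ weilPrimeIndex a, ∀ k' ∈ weilPrimeIndex a,
      (Λ k : ℝ) / Real.sqrt k * ((Λ k' : ℝ) / Real.sqrt k') = 0 ∨
        (0 ≤ sp k k' ∧ sp k k' ≤ |Real.sin ((π * Real.log k / a + π * Real.log k' / a) / 2)|) :=
    fun k hk k' hk' ↦ by
      by_cases hkp : IsPrimePow k ∧ IsPrimePow k'
      · exact Or.inr (hsp k hk k' hk' hkp.1 hkp.2)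
      · refine Or.inl ?_
        rcases not_and_or.mp hkp with h | h
        · rw [hwz k h, zero_mul]
        · rw [hwz k' h, mul_zero]
  -- non-negativity of c̄
  have hκ : 0 ≤ (π / 2) * (∑ k ∈ weilPrimeIndex a, if s₁ k = 0 then (Λ k : ℝ) / Real.sqrt k else 0)
      + (∑ k ∈ weilPrimeIndex a, ∑ k' ∈ (weilPrimeIndex a).erase k,
          if sm k k' = 0 then (Λ k : ℝ) / Real.sqrt k * ((Λ k' : ℝ) / Real.sqrt k') else 0) / 2
      + (∑ k ∈ weilPrimeIndex a, ∑ k' ∈ weilPrimeIndex a,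
          if sp k k' = 0 then (Λ k : ℝ) / Real.sqrt k * ((Λ k' : ℝ) / Real.sqrt k') else 0) / 2 := by
    have h1 := Finset.sum_nonneg fun k (_ : k ∈ weilPrimeIndex a) ↦
      show 0 ≤ (if s₁ k = 0 then (Λ k : ℝ) / Real.sqrt k else 0) by split_ifs; exacts [hw k, le_rfl]
    have h2 := Finset.sum_nonneg fun k (_ : k ∈ weilPrimeIndex a) ↦
      Finset.sum_nonneg fun k' (_ : k' ∈ (weilPrimeIndex a).erase k) ↦
        show 0 ≤ (if sm k k' = 0 then (Λ k : ℝ) / Real.sqrt k * ((Λ k' : ℝ) / Real.sqrt k') else 0) by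
          split_ifs; exacts [mul_nonneg (hw k) (hw k'), le_rfl]
    have h3 := Finset.sum_nonneg fun k (_ : k ∈ weilPrimeIndex a) ↦
      Finset.sum_nonneg fun k' (_ : k' ∈ weilPrimeIndex a) ↦
        show 0 ≤ (if sp k k' = 0 then (Λ k : ℝ) / Real.sqrt k * ((Λ k' : ℝ) / Real.sqrt k') else 0) by
          split_ifs; exacts [mul_nonneg (hw k) (hw k'), le_rfl]
    positivity
  have hW1 := Finset.sum_nonneg fun k (_ : k ∈ weilPrimeIndex a) ↦ hw k
  have hcbar : 0 ≤ (π / 4 + a * (1 + weilArchDensity (2 * a)) / (π * B₃)) ^ 2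
      + (∑ k ∈ weilPrimeIndex a, ((Λ k : ℝ) / Real.sqrt k) ^ 2) / 2
      + 2 * (a * (1 + weilArchDensity (2 * a)) / (π * B₃)) * (∑ k ∈ weilPrimeIndex a, (Λ k : ℝ) / Real.sqrt k)
      + ((π / 2) * (∑ k ∈ weilPrimeIndex a, if s₁ k = 0 then (Λ k : ℝ) / Real.sqrt k else 0)
        + (∑ k ∈ weilPrimeIndex a, ∑ k' ∈ (weilPrimeIndex a).erase k,
            if sm k k' = 0 then (Λ k : ℝ) / Real.sqrt k * ((Λ k' : ℝ) / Real.sqrt k') else 0) / 2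
        + (∑ k ∈ weilPrimeIndex a, ∑ k' ∈ weilPrimeIndex a,
            if sp k k' = 0 then (Λ k : ℝ) / Real.sqrt k * ((Λ k' : ℝ) / Real.sqrt k') else 0) / 2) := by
    have h2 := Finset.sum_nonneg fun k (_ : k ∈ weilPrimeIndex a) ↦ sq_nonneg ((Λ k : ℝ) / Real.sqrt k)
    positivity
  -- per-mode split
  have hmode : ∀ m ∈ Finset.Ico B₃ N,
      ((Complex.digamma (1 / 4 + ((freq a m : ℝ) : ℂ) / 2 * I)).im / 2
          + (∑ k ∈ weilPrimeIndex a, (Λ k : ℝ) / Real.sqrt k * Real.sin (freq a m * Real.log k))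
          - archExpSumSin a m) ^ 2
        ≤ ((π / 4 + a * (1 + weilArchDensity (2 * a)) / (π * B₃)) ^ 2
            + (∑ k ∈ weilPrimeIndex a, ((Λ k : ℝ) / Real.sqrt k) ^ 2) / 2
            + 2 * (a * (1 + weilArchDensity (2 * a)) / (π * B₃)) * (∑ k ∈ weilPrimeIndex a, (Λ k : ℝ) / Real.sqrt k)
            + ((π / 2) * (∑ k ∈ weilPrimeIndex a, if s₁ k = 0 then (Λ k : ℝ) / Real.sqrt k else 0)
              + (∑ k ∈ weilPrimeIndex a, ∑ k' ∈ (weilPrimeIndex a).erase k,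
                  if sm k k' = 0 then (Λ k : ℝ) / Real.sqrt k * ((Λ k' : ℝ) / Real.sqrt k') else 0) / 2
              + (∑ k ∈ weilPrimeIndex a, ∑ k' ∈ weilPrimeIndex a,
                  if sp k k' = 0 then (Λ k : ℝ) / Real.sqrt k * ((Λ k' : ℝ) / Real.sqrt k') else 0) / 2))
          + ((π / 2) * (∑ k ∈ weilPrimeIndex a, (if s₁ k = 0 then (0 : ℝ) else 1) * ((Λ k : ℝ) / Real.sqrt k)
                * Real.sin ((m : ℝ) * (π * Real.log k / a)))
            + (∑ k ∈ weilPrimeIndex a, ∑ k' ∈ (weilPrimeIndex a).erase k,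
                (if sm k k' = 0 then (0 : ℝ) else 1) * ((Λ k : ℝ) / Real.sqrt k * ((Λ k' : ℝ) / Real.sqrt k'))
                  * Real.cos ((m : ℝ) * (π * Real.log k / a - π * Real.log k' / a))) / 2
            - (∑ k ∈ weilPrimeIndex a, ∑ k' ∈ weilPrimeIndex a,
                (if sp k k' = 0 then (0 : ℝ) else 1) * ((Λ k : ℝ) / Real.sqrt k * ((Λ k' : ℝ) / Real.sqrt k'))
                  * Real.cos ((m : ℝ) * (π * Real.log k / a + π * Real.log k' / a))) / 2) := by
    intro m hm
    have hmB : B₃ ≤ m := (Finset.mem_Ico.mp hm).1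
    have hm1 : 1 ≤ m := le_trans hB₃1 hmB
    have hBm : (B₃ : ℝ) ≤ m := by exact_mod_cast hmB
    have hG : |(Complex.digamma (1 / 4 + ((freq a m : ℝ) : ℂ) / 2 * I)).im / 2 - archExpSumSin a m - π / 4|
        ≤ a * (1 + weilArchDensity (2 * a)) / (π * B₃) :=
      (abs_smoothMode_sub_le ha hm1).trans
        (div_le_div_of_nonneg_left (by positivity) (by positivity) (mul_le_mul_of_nonneg_left hBm Real.pi_pos.le))
    have h := modeSq_le (weilPrimeIndex a) (fun k ↦ (Λ k : ℝ) / Real.sqrt k) (fun k ↦ π * Real.log k / a) hw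
      (m : ℝ) ((Complex.digamma (1 / 4 + ((freq a m : ℝ) : ℂ) / 2 * I)).im / 2) (archExpSumSin a m) hc hG s₁ sm sp
    simp only [freq_mul_log_eq]
    exact h
  -- oscillatory Gram entries
  have hρ := fun j j' : Fin D ↦ abs_sum_Ico_osc_div_pow_le (weilPrimeIndex a) (fun k ↦ (Λ k : ℝ) / Real.sqrt k)
    (fun k ↦ π * Real.log k / a) hw s₁ sm sp hs₁' hsm' hsp' hB₃1 (e j + e j') N
  -- assembly
  exact sum_sq_mul_sq_le_of_mode_bounds (Finset.Ico B₃ N) _ _ hcbar e α lam hlam hmode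
    (sum_Ico_sq_sum_div_pow_le e he hB₃ lam hlam N α) _ hρ (fun j j' ↦ by rw [Nat.add_comm (e j) (e j')])

end MeanSquare

end Summit.RiemannHypothesis.RiemannHypothesis.Theorems.WeilFormatC

end
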